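import Summits.AtomisticToContinuum.BoseEinsteinCondensation.Theses.BECConjugateDomination
import Literature.MathematicalPhysics.QuantumManyBody.CoherenceZeroMode
import HarnessLib

/-!
# The uniform chain glue: stub `stub_uniformChainGlue` (S4) of line `third-law-current-floor`
# for crux `BECConjugateDomination.HardCoreExtension` (stmt-AtomisticToContinuum-11786)

Stub S4 of the lead's skeleton `work/HardCoreExtension.lean` (route
`route-AtomisticToContinuum-BECConjugateDomination`), landed as a `--supports` file of the crux item.
It is the route's glue `IMUChainGlue` (stmt-11790), steps (i)–(vi), with `PuffFloor` replaced by the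
uniform QUADRATIC structure-factor floor (hypothesis (1), proved in the skeleton from S1 + S2) and
with every constant uniform over the bounded admissible potentials of range `≤ R`:

  quadratic floor → uniform Lévy bound → `ShortDistanceCoherence` → minimiser BEC `n₀ ≥ N/2`.

All the analysis is in the Literature support files written for this stub:
`TorusAutocorrelationKernel` (Wiener–Khinchin on `(ℝ/ℤ)ᵈ`, polarised Parseval, the zero-mode
inequality), `TorusTentKernel` (the bump), `PeriodicCondensateCoherence` (cell shifts on the torus,
`n₀ = (N/L³)∫_cell g`), `PeriodicCoherenceFunction` (continuity/positivity/periodicity of `g`,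
`L³(1 + ν₀) ≤ ∫g`), `PeriodicKineticBudget` (`T ≤ 16πRρN` uniformly via LSSY Thm. 2.2 for the hard
core `2R`; the `d = 3` infrared lattice sum; the real bookkeeping) and `CoherenceZeroMode` (the
per-state inequality `ν₀ ≥ -1/3 - √ρ·C_E`). This file only chooses the constants
(`d₀ = min(1, 1/(1600R))`, `C_E = C_I(16 + 136C_F)/d₀³`, `ρ₀ = min(ρ_F, ρ_I, ρ_T, 1, (6(C_E+1))⁻²)`,
`c = ½`), collects the eventualities in `n` (for `N = n + 1`) and shifts the index.

References: the line card `Ideas/third-law-current-floor.md`; S. Stringari, in *Bose–Einstein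
Condensation*, CUP 1995, §2.2 [Stringari1995]; C. Mora, Y. Castin, Phys. Rev. A 67 (2003) 053615
§4.3 [MoraCastin2003]; E. H. Lieb, R. Seiringer, J. P. Solovej, J. Yngvason, *The Mathematics of the
Bose Gas and its Condensation* (2005), Thm. 2.2 (2.14), §1.2 [LSSY2005].
-/

noncomputable section

namespace Summit.AtomisticToContinuum.BoseEinsteinCondensation.Cruxes.HardCoreExtension.ThirdLawCurrentFloor

open MeasureTheory Filter
open scoped ENNReal NNReal BigOperators
open Literature.MathematicalPhysics.QuantumManyBody.BoseGas
open Summit.AtomisticToContinuum.BoseEinsteinCondensation.Theses.BECConjugateDomination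

/-- From `∀ᶠ n, P (n + 1)` to `∀ᶠ N, P N`. [folklore] -/
theorem eventually_atTop_of_succ {P : ℕ → Prop} (h : ∀ᶠ n : ℕ in atTop, P (n + 1)) :
    ∀ᶠ N : ℕ in atTop, P N := by
  rw [Filter.eventually_atTop] at h ⊢
  obtain ⟨n₀, hn₀⟩ := h
  refine ⟨n₀ + 1, fun N hN => ?_⟩
  obtain ⟨n, rfl⟩ : ∃ n, N = n + 1 := ⟨N - 1, by omega⟩
  exact hn₀ n (by omega)

/-- **S4 `stub_uniformChainGlue`** (the uniform chain glue of line `third-law-current-floor`).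
HYPOTHESES: (1) the uniform quadratic structure-factor floor `min(½, |k_m|²/(16C_Fρ)) ≤ S_m`;
(2) the uniform Lévy bound `(n+1)·ν_m·S_m ≤ C_I` (`m ≠ 0`; both for positive real minimisers of
every bounded admissible `v` of range `≤ R`, `∀ᶠ n` before `∀ v`); (3) the route's support
`ShortDistanceCoherence` by name. CONCLUSION: for every `R > 0` there is `ρ₀ > 0` such that for
`0 < ρ < ρ₀`, with `c = ½`, for all large `N`, every positive real minimiser `Ψ` of every bounded
admissible `v` of range `≤ R` on the torus of side `(N/ρ)^{1/3}` has `n₀(Ψ) ≥ N/2`.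
Proof (steps (i)–(vi) of the route's glue, constants uniform in `v` at fixed `R`):
(i)+(ii) `n₀ = (N/L³)∫_cell g ≥ N(1 + ν₀)` (`condensateOccupation_eq_ofReal_integral_coherence`,
`volume_mul_one_add_zero_mode_le`: `g ≥ 1 + log g`); (iv) `T ≤ 16πRρN` for minimisers of every
`v` of range `≤ R` (`kinetic_le_of_minimiser_uniform`: monotonicity in `v` + LSSY Thm. 2.2 for the
hard core of radius `2R`), so `ShortDistanceCoherence` gives `g(y) ≥ 1 - 8πRρ‖y‖²` on `ℝ³`;
(iii)+(v) `log_coherence_zero_mode_ge` (tent-autocorrelation kernel of radius `d₀/(L√ρ)` on the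
torus, Wiener–Khinchin + Parseval, the floor and the Lévy bound mode by mode, the `d = 3` infrared
lattice sum): `ν₀ ≥ -1/3 - √ρ·C_I(16 + 136C_F)/d₀³` with `d₀ = min(1, 1/(1600R))`;
(vi) `ρ₀ = min(ρ_F, ρ_I, ρ_T, 1, (6(C_E+1))⁻²)`, `C_E = C_I(16+136C_F)/d₀³`, makes `ν₀ ≥ -½`, whence
`n₀ ≥ N/2`; the index shift `n + 1 ↦ N` is `eventually_atTop_of_succ`.
[cite: Stringari1995, §2.2; LSSY2005, Thm. 2.2 (2.14) and §1.2] -/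
theorem stub_uniformChainGlue :
    (∀ R : ℝ, 0 < R → ∃ C : ℝ, 0 < C ∧ ∃ ρ₀ : ℝ, 0 < ρ₀ ∧ ∀ ρ : ℝ, 0 < ρ → ρ < ρ₀ →
      ∀ᶠ n : ℕ in atTop, ∀ v : ℝ → ℝ≥0∞, IsRepulsiveFiniteRange v →
        (∃ M : ℝ≥0∞, M ≠ ⊤ ∧ ∀ r, v r ≤ M) → (∀ r, R < r → v r = 0) →
        ∀ Ψ : PeriodicTrialState (n + 1) (sideLength ρ (n + 1)),
          periodicEnergy v Ψ = periodicGroundStateEnergy v (n + 1) (sideLength ρ (n + 1)) →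
          periodicEnergy v Ψ ≠ ⊤ → (∀ X, Ψ.ψ X = (‖Ψ.ψ X‖ : ℂ)) → (∀ X, Ψ.ψ X ≠ 0) →
          ∀ m : Fin 3 → ℤ, m ≠ 0 →
            min (1 / 2 : ℝ)
                (‖(2 * Real.pi / sideLength ρ (n + 1)) • latticeVec 1 m‖ ^ 2 / (16 * C * ρ)) ≤
              ((n : ℝ) + 1)⁻¹ *
                ∫ X in cellN (n + 1) (sideLength ρ (n + 1)),
                  ‖∑ j : Fin (n + 1), cellWave (sideLength ρ (n + 1)) m (X j)‖ ^ 2 * ‖Ψ.ψ X‖ ^ 2) →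
    (∀ R : ℝ, 0 < R → ∃ C : ℝ, 0 ≤ C ∧ ∃ ρ₀ : ℝ, 0 < ρ₀ ∧ ∀ ρ : ℝ, 0 < ρ → ρ < ρ₀ →
      ∀ᶠ n : ℕ in atTop, ∀ v : ℝ → ℝ≥0∞, IsRepulsiveFiniteRange v →
        (∃ M : ℝ≥0∞, M ≠ ⊤ ∧ ∀ r, v r ≤ M) → (∀ r, R < r → v r = 0) →
        ∀ Ψ : PeriodicTrialState (n + 1) (sideLength ρ (n + 1)),
          (let L : ℝ := sideLength ρ (n + 1)
           let g : Space → ℝ := fun r => ∫ x in cell L, ∫ Y in cellN n L,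
             ‖Ψ.ψ (Matrix.vecCons (x + r) Y)‖ * ‖Ψ.ψ (Matrix.vecCons x Y)‖
           let ν : (Fin 3 → ℤ) → ℝ := fun m =>
             (cellFourierCoeff L (fun r : Space => ((Real.log (g r) : ℝ) : ℂ)) m).re
           let S : (Fin 3 → ℤ) → ℝ := fun m => ((n : ℝ) + 1)⁻¹ *
             ∫ X in cellN (n + 1) L, ‖∑ j : Fin (n + 1), cellWave L m (X j)‖ ^ 2 * ‖Ψ.ψ X‖ ^ 2
           periodicEnergy v Ψ = periodicGroundStateEnergy v (n + 1) L → periodicEnergy v Ψ ≠ ⊤ →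
           (∀ X, Ψ.ψ X = (‖Ψ.ψ X‖ : ℂ)) → (∀ X, Ψ.ψ X ≠ 0) →
           ∀ m : Fin 3 → ℤ, m ≠ 0 → ((n : ℝ) + 1) * ν m * S m ≤ C)) →
    ShortDistanceCoherence →
    ∀ R : ℝ, 0 < R → ∃ ρ₀ : ℝ, 0 < ρ₀ ∧ ∀ ρ : ℝ, 0 < ρ → ρ < ρ₀ → ∃ c : ℝ, 0 < c ∧
      ∀ᶠ N : ℕ in atTop, ∀ v : ℝ → ℝ≥0∞, IsRepulsiveFiniteRange v →
        (∃ M : ℝ≥0∞, M ≠ ⊤ ∧ ∀ r, v r ≤ M) → (∀ r, R < r → v r = 0) →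
        ∀ Ψ : PeriodicTrialState N (sideLength ρ N),
          periodicEnergy v Ψ = periodicGroundStateEnergy v N (sideLength ρ N) →
          periodicEnergy v Ψ ≠ ⊤ → (∀ X, Ψ.ψ X = (‖Ψ.ψ X‖ : ℂ)) → (∀ X, Ψ.ψ X ≠ 0) →
          ENNReal.ofReal (c * N) ≤ condensateOccupation N (sideLength ρ N) Ψ.ψ := by
  intro hF hI hsdc R hR
  obtain ⟨C_F, hCF, ρF, hρF, hFev⟩ := hF R hR
  obtain ⟨C_I, hCI, ρI, hρI, hIev⟩ := hI R hR
  obtain ⟨ρT, hρT, hTev⟩ := kinetic_le_of_minimiser_uniform hR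
  -- the constants of the line: kernel radius `d₀`, error constant `C_E`, density threshold `ρ₀`
  set d₀ : ℝ := min 1 (1 / (1600 * R)) with hd₀def
  have hd₀ : 0 < d₀ := lt_min one_pos (by positivity)
  have hd₀1 : d₀ ≤ 1 := min_le_left _ _
  have hd₀R : d₀ ≤ 1 / (1600 * R) := min_le_right _ _
  set C_E : ℝ := C_I * (16 + 136 * C_F) / d₀ ^ 3 with hCEdef
  have hCE : 0 ≤ C_E := by positivity
  set ρ₀ : ℝ := min (min (min ρF ρI) (min ρT 1)) ((1 / (6 * (C_E + 1))) ^ 2) with hρ₀def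
  have hρ₀ : 0 < ρ₀ := lt_min (lt_min (lt_min hρF hρI) (lt_min hρT one_pos)) (by positivity)
  refine ⟨ρ₀, hρ₀, fun ρ hρ hρlt => ?_⟩
  have hρF' : ρ < ρF := hρlt.trans_le ((min_le_left _ _).trans ((min_le_left _ _).trans (min_le_left _ _)))
  have hρI' : ρ < ρI := hρlt.trans_le ((min_le_left _ _).trans ((min_le_left _ _).trans (min_le_right _ _)))
  have hρT' : ρ < ρT := hρlt.trans_le ((min_le_left _ _).trans ((min_le_right _ _).trans (min_le_left _ _)))
  have hρE : ρ < (1 / (6 * (C_E + 1))) ^ 2 := hρlt.trans_le (min_le_right _ _)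
  -- `s = √ρ`
  set s : ℝ := Real.sqrt ρ with hsdef
  have hs : 0 < s := Real.sqrt_pos.2 hρ
  have hsρ : s ^ 2 = ρ := Real.sq_sqrt hρ.le
  have hsE : s * C_E ≤ 1 / 6 := by
    have h1 : s < 1 / (6 * (C_E + 1)) := by
      rw [hsdef, Real.sqrt_lt' (by positivity)]; exact hρE
    have h2 : s * (C_E + 1) < 1 / 6 := by
      rw [lt_div_iff₀ (by positivity)] at h1
      linarith
    nlinarith
  refine ⟨1 / 2, by norm_num, ?_⟩
  -- eventualities in `n` (for `N = n + 1`)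
  have hT' := (tendsto_add_atTop_nat 1).eventually (hTev ρ hρ hρT')
  have hL' : ∀ᶠ n : ℕ in atTop, d₀ / s ≤ sideLength ρ (n + 1) :=
    (tendsto_add_atTop_nat 1).eventually ((tendsto_sideLength_atTop hρ).eventually_ge_atTop _)
  have key : ∀ᶠ n : ℕ in atTop, ∀ v : ℝ → ℝ≥0∞, IsRepulsiveFiniteRange v →
      (∃ M : ℝ≥0∞, M ≠ ⊤ ∧ ∀ r, v r ≤ M) → (∀ r, R < r → v r = 0) →
      ∀ Ψ : PeriodicTrialState (n + 1) (sideLength ρ (n + 1)),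
        periodicEnergy v Ψ = periodicGroundStateEnergy v (n + 1) (sideLength ρ (n + 1)) →
        periodicEnergy v Ψ ≠ ⊤ → (∀ X, Ψ.ψ X = (‖Ψ.ψ X‖ : ℂ)) → (∀ X, Ψ.ψ X ≠ 0) →
        ENNReal.ofReal (1 / 2 * ((n + 1 : ℕ) : ℝ)) ≤
          condensateOccupation (n + 1) (sideLength ρ (n + 1)) Ψ.ψ := by
    filter_upwards [hFev ρ hρ hρF', hIev ρ hρ hρI', hT', hL'] with n hFn hIn hTn hLn
    intro v hv hbdd hvR Ψ hmin hfin hreal hpos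
    have hN0 : 0 < n + 1 := Nat.succ_pos n
    have hL : 0 < sideLength ρ (n + 1) := by
      unfold sideLength; exact Real.rpow_pos_of_pos (div_pos (by exact_mod_cast hN0) hρ) _
    have hNρ : ((n : ℝ) + 1) = ρ * sideLength ρ (n + 1) ^ 3 := by
      have h := div_sideLength_pow_three hρ hN0
      rw [div_eq_iff (pow_ne_zero _ hL.ne')] at h
      push_cast at h
      linarith
    -- the kinetic budget `T ≤ 16πRρN`
    have hkin := hTn v hvR Ψ hmin
    have hkin_ne : (∫⁻ X in cellN (n + 1) (sideLength ρ (n + 1)), kineticDensity Ψ.ψ X) ≠ ⊤ :=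
      ne_top_of_le_ne_top ENNReal.ofReal_ne_top hkin
    set T : ℝ := (∫⁻ X in cellN (n + 1) (sideLength ρ (n + 1)), kineticDensity Ψ.ψ X).toReal with hTdef
    have hT0 : 0 ≤ T := ENNReal.toReal_nonneg
    have hTle : T ≤ 16 * Real.pi * R * ρ * ((n : ℝ) + 1) := by
      have := ENNReal.toReal_mono ENNReal.ofReal_ne_top hkin
      rw [ENNReal.toReal_ofReal (by positivity)] at this
      push_cast at this
      linarith
    -- the local coherence bound from `ShortDistanceCoherence`
    set τ : ℝ := T / (2 * ((n : ℝ) + 1)) with hτdef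
    have hτ : 0 ≤ τ := by positivity
    have hτle : τ ≤ 8 * Real.pi * R * ρ := by
      rw [hτdef, div_le_iff₀ (by positivity)]; linarith
    have hlow : ∀ y : Space, 1 - τ * ‖y‖ ^ 2 ≤ ∫ x in cell (sideLength ρ (n + 1)),
        ∫ Y in cellN n (sideLength ρ (n + 1)),
          ‖Ψ.ψ (Matrix.vecCons (x + y) Y)‖ * ‖Ψ.ψ (Matrix.vecCons x Y)‖ := by
      intro y
      have h := hsdc n (sideLength ρ (n + 1)) hL Ψ hkin_ne y
      have : ‖y‖ ^ 2 * T / (2 * ((n : ℝ) + 1)) = τ * ‖y‖ ^ 2 := by rw [hτdef]; ring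
      rw [← this]; exact h
    have hτd : 3 * τ * (2 * d₀ / s) ^ 2 ≤ 1 / 4 := by
      -- `3τ(2d₀/s)² = 12 τ d₀²/ρ ≤ 96 π R d₀² ≤ 96 π R d₀/(1600 R) ≤ 96·4/1600 < 1/4`
      have hd₀sq : d₀ ^ 2 ≤ 1 / (1600 * R) := by nlinarith
      have h1 : 3 * τ * (2 * d₀ / s) ^ 2 = 12 * τ * d₀ ^ 2 / ρ := by
        rw [← hsρ]; field_simp; ring
      rw [h1, div_le_iff₀ hρ]
      have h2 : 12 * τ * d₀ ^ 2 ≤ 12 * (8 * Real.pi * R * ρ) * (1 / (1600 * R)) :=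
        mul_le_mul (mul_le_mul_of_nonneg_left hτle (by norm_num)) hd₀sq (by positivity) (by positivity)
      have h3 : 12 * (8 * Real.pi * R * ρ) * (1 / (1600 * R)) = 96 * Real.pi * ρ / 1600 := by
        field_simp; ring
      have hπ := Real.pi_le_four
      rw [h3] at h2
      nlinarith
    have hδ1 : d₀ / (sideLength ρ (n + 1) * s) ≤ 1 := by
      rw [div_le_one (by positivity)]
      rw [div_le_iff₀ hs] at hLn
      linarith
    -- the zero mode
    have hz := log_coherence_zero_mode_ge hL Ψ hpos hCF hCI hρ hs hsρ hd₀ hd₀1 hNρ hδ1 hτ hτd hlow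
      (hFn v hv hbdd hvR Ψ hmin hfin hreal hpos) (hIn v hv hbdd hvR Ψ hmin hfin hreal hpos)
    have hν : -(1 / 2 : ℝ) ≤ (cellFourierCoeff (sideLength ρ (n + 1)) (fun r : Space =>
        ((Real.log (∫ x in cell (sideLength ρ (n + 1)), ∫ Y in cellN n (sideLength ρ (n + 1)),
          ‖Ψ.ψ (Matrix.vecCons (x + r) Y)‖ * ‖Ψ.ψ (Matrix.vecCons x Y)‖) : ℝ) : ℂ)) 0).re := by
      have : s * (C_I * (16 + 136 * C_F) / d₀ ^ 3) = s * C_E := by rw [hCEdef]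
      rw [this] at hz
      linarith
    -- steps (i)–(ii)
    have hgc := continuous_coherenceFun hL Ψ
    have hg0 := coherenceFun_pos hL Ψ hpos
    have hvol := volume_mul_one_add_zero_mode_le hL hgc hg0
    rw [condensateOccupation_eq_ofReal_integral_coherence hL Ψ hreal]
    apply ENNReal.ofReal_le_ofReal
    have hL3 : 0 < sideLength ρ (n + 1) ^ 3 := by positivity
    have hIg : sideLength ρ (n + 1) ^ 3 * (1 / 2) ≤
        ∫ r in cell (sideLength ρ (n + 1)), ∫ x in cell (sideLength ρ (n + 1)),
          ∫ Y in cellN n (sideLength ρ (n + 1)),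
            ‖Ψ.ψ (Matrix.vecCons (x + r) Y)‖ * ‖Ψ.ψ (Matrix.vecCons x Y)‖ := by
      nlinarith [hvol, hν]
    have hfinal : (1 / 2 : ℝ) * ((n + 1 : ℕ) : ℝ) ≤ ((n : ℝ) + 1) * ((sideLength ρ (n + 1) ^ 3)⁻¹ *
        ∫ r in cell (sideLength ρ (n + 1)), ∫ x in cell (sideLength ρ (n + 1)),
          ∫ Y in cellN n (sideLength ρ (n + 1)),
            ‖Ψ.ψ (Matrix.vecCons (x + r) Y)‖ * ‖Ψ.ψ (Matrix.vecCons x Y)‖) := by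
      calc (1 / 2 : ℝ) * ((n + 1 : ℕ) : ℝ)
          = ((n : ℝ) + 1) * ((sideLength ρ (n + 1) ^ 3)⁻¹ * (sideLength ρ (n + 1) ^ 3 * (1 / 2))) := by
            field_simp; push_cast; ring
        _ ≤ _ := by gcongr
    convert hfinal using 1
  -- from `n + 1` to `N`
  exact eventually_atTop_of_succ key

end Summit.AtomisticToContinuum.BoseEinsteinCondensation.Cruxes.HardCoreExtension.ThirdLawCurrentFloor

end
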